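import Mathlib
import Summits.Ventures.PercRepro2.CrossAPrimeA2VEdge

/-!
# The row-pair kernel of `crossC`: the crux is a double sum over pairs of `a₂`-clusters,
negative exactly on the split pairs
(blind cell PercRepro2, p5 g39; `proofs/subclaims/S4-HARDSTEP.md` §2.4 (s) addendum 51 (1))

Explore the cluster `K = C(a₂)`: on `Q = {a₁ ∉ K}` every `v`-mass of `crossC` is the expectation of a
cluster functional (`prob_clusterIn_inter_avoid_eq_expect`, BHK's tower identity), with
`γ(K) = P(a₁ ↔ v in G ∖ K)` (`delClusterProb`).  Writing, per configuration `ω` with cluster `K`,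
the six ROW VALUES `Z = 1_Q`, `X = 1_Q·1_o(K)`, `Y = 1_Q·1_b(K)`, `XV = 1_Q·1_o(K)·γ(K)`,
`YV = 1_Q·1_b(K)·γ(K)`, `DV = 1_Q·1_o(K)1_b(K)·γ(K)` (`rowZ`, `rowX`, …), the six masses are their
expectations (`expect_rowX_eq` …) and the symmetric bilinear form of `crossC` becomes a DOUBLE SUM
over ordered pairs of configurations:

  `2·crossC(p; c) = Σ_{ω, ω′} weight(ω)·weight(ω′)·Φ_c(ω, ω′)`,
  `Φ_c = 2(Z·DV′ + Z′·DV) − (Y·XV′ + Y′·XV) − (X·YV′ + X′·YV) + c(X·Y′ + X′·Y)`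

(**`two_mul_crossC_eq_rowPair_sum`**).  The SIGN TABLE (**`rowPair_nonneg_of_not_split`**): with
`0 ≤ γ, γ′ ≤ c`, `Φ_c ≥ 0` unless the pair is SPLIT — `o ∈ K ∌ b` and `b ∈ K′ ∌ o` (or the mirror) —
where `Φ_c = c − γ − γ′` (**`rowPair_split`**): the whole negativity of the crux sits on pairs of
clusters one of which holds `o` without `b` and the other `b` without `o`, and which together leave
the `a₁–v` connection more than `c`-likely.  Census: 15,790 instances, 733,609 pairs, 2,006
negative, all split (own code).  Own work; standard axioms.
-/

namespace Summit.Ventures.PercRepro2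

open LeafRowPendantRootSO CrossAPrimeSupport CrossAPrimeA2Route CrossAPrimeA2Induction
  CrossAPrimeA2VEdge

namespace CrossAPrimeRowPairs

section Rows

variable {V : Type*} {E : Type*} [Fintype E] [DecidableEq E] [Fintype V] [DecidableEq V]
  {R : Type*} [Field R]
variable {ends : E → Sym2 V}

/-- `γ(K) = P(a₁ ↔ v in G ∖ K)`. -/
noncomputable def gam (p : E → R) (ends : E → Sym2 V) (a₁ v : V) (K : Set V) : R :=
  delClusterProb p ends a₁ {B : Set V | v ∈ B} K

/-- The row value of `Z`: `1_Q`. -/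
noncomputable def rowZ (ends : E → Sym2 V) (a₁ a₂ : V) (ω : Config E) : R :=
  (avoidAll ends a₂ {a₁}).indicator 1 ω

/-- The row value of `x`: `1_Q · 1_{o ∈ K}`. -/
noncomputable def rowX (ends : E → Sym2 V) (o a₁ a₂ : V) (ω : Config E) : R :=
  ({A : Set V | o ∈ A} : Set (Set V)).indicator 1 (cluster ends ω a₂) *
    (avoidAll ends a₂ {a₁}).indicator 1 ω

/-- The row value of `xv`: `1_Q · 1_{o ∈ K} · γ(K)`. -/
noncomputable def rowXV (p : E → R) (ends : E → Sym2 V) (o a₁ a₂ v : V) (ω : Config E) : R :=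
  ({A : Set V | o ∈ A} : Set (Set V)).indicator 1 (cluster ends ω a₂) *
    gam p ends a₁ v (cluster ends ω a₂) * (avoidAll ends a₂ {a₁}).indicator 1 ω

/-- The row value of `Dv`: `1_Q · 1_{o ∈ K} · 1_{b ∈ K} · γ(K)`. -/
noncomputable def rowDV (p : E → R) (ends : E → Sym2 V) (o a₁ a₂ v b : V) (ω : Config E) : R :=
  ({A : Set V | o ∈ A ∧ b ∈ A} : Set (Set V)).indicator 1 (cluster ends ω a₂) *
    gam p ends a₁ v (cluster ends ω a₂) * (avoidAll ends a₂ {a₁}).indicator 1 ω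

omit [Fintype V] [DecidableEq V] in
/-- `Z = E[rowZ]`. -/
lemma expect_rowZ_eq (p : E → R) (a₁ a₂ : V) :
    expect p (rowZ (R := R) ends a₁ a₂) = prob p (avoidAll ends a₂ {a₁}) := by
  unfold rowZ
  exact (prob_eq_expect_indicator p _).symm

/-- `x = E[rowX]` (and `y` with `b` for `o`). -/
lemma expect_rowX_eq (p : E → R) (o a₁ a₂ : V) :
    expect p (rowX (R := R) ends o a₁ a₂) = prob p (avoidAll ends a₂ {a₁} ∩ connEvent ends a₂ o) := by
  rw [prob_eq_expect_indicator, connEvent_eq_clusterInEvent']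
  unfold expect
  refine Finset.sum_congr rfl fun ω _ => ?_
  rw [indicator_inter_one]
  simp only [rowX, clusterInEvent, Set.indicator, Set.mem_setOf_eq, mem_cluster]
  split_ifs <;> simp_all

omit [DecidableEq V] in
/-- `xv = E[rowXV]` (and `yv` with `b` for `o`): the tower identity. -/
lemma expect_rowXV_eq (p : E → R) (o a₁ a₂ v : V) :
    expect p (rowXV p ends o a₁ a₂ v) =
      prob p (avoidAll ends a₂ {a₁} ∩ (connEvent ends a₁ v ∩ connEvent ends a₂ o)) := by
  have h := prob_clusterIn_inter_avoid_eq_expect p ends a₂ a₁ (Finset.mem_singleton_self a₁)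
    {A : Set V | o ∈ A} {B : Set V | v ∈ B}
  rw [← connEvent_eq_clusterInEvent', ← connEvent_eq_clusterInEvent_v] at h
  have e : connEvent ends a₂ o ∩ connEvent ends a₁ v ∩ avoidAll ends a₂ {a₁} =
      avoidAll ends a₂ {a₁} ∩ (connEvent ends a₁ v ∩ connEvent ends a₂ o) := by
    ext ω; simp only [Set.mem_inter_iff]; tauto
  rw [e] at h
  unfold rowXV gam
  exact h.symm

omit [DecidableEq V] in
/-- `Dv = E[rowDV]`: the tower identity for the pair `{o, b ∈ K}`. -/
lemma expect_rowDV_eq (p : E → R) (o a₁ a₂ v b : V) :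
    expect p (rowDV p ends o a₁ a₂ v b) =
      prob p (avoidAll ends a₂ {a₁} ∩
        (connEvent ends a₁ v ∩ (connEvent ends a₂ o ∩ connEvent ends a₂ b))) := by
  have h := prob_clusterIn_inter_avoid_eq_expect p ends a₂ a₁ (Finset.mem_singleton_self a₁)
    {A : Set V | o ∈ A ∧ b ∈ A} {B : Set V | v ∈ B}
  rw [← connEvent_eq_clusterInEvent_v] at h
  have e : clusterInEvent ends a₂ {A : Set V | o ∈ A ∧ b ∈ A} ∩ connEvent ends a₁ v ∩
      avoidAll ends a₂ {a₁} = avoidAll ends a₂ {a₁} ∩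
        (connEvent ends a₁ v ∩ (connEvent ends a₂ o ∩ connEvent ends a₂ b)) := by
    ext ω
    simp only [Set.mem_inter_iff, mem_clusterInEvent, Set.mem_setOf_eq, mem_cluster, connEvent]
    tauto
  rw [e] at h
  unfold rowDV gam
  exact h.symm

end Rows

section Kernel

variable {R : Type*} [Field R]

/-- **The row-pair kernel**: on two rows `(Z, X, Y, XV, YV, DV)`, `(Z', X', Y', XV', YV', DV')`,
`Φ_c = 2(Z·DV' + Z'·DV) − (Y·XV' + Y'·XV) − (X·YV' + X'·YV) + c(X·Y' + X'·Y)`. -/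
def rowPair (c Z X Y XV YV DV Z' X' Y' XV' YV' DV' : R) : R :=
  2 * (Z * DV' + Z' * DV) - (Y * XV' + Y' * XV) - (X * YV' + X' * YV) + c * (X * Y' + X' * Y)

/-- **The sign table, non-split pairs**: the row values of a single configuration are
`Z = z`, `X = z·io`, `Y = z·ib`, `XV = z·io·g`, `YV = z·ib·g`, `DV = z·io·ib·g` with `z, io, ib ∈ {0, 1}`
and `0 ≤ g ≤ c`; unless `io = 1, ib = 0, io' = 0, ib' = 1` or the mirror, the kernel is nonnegative. -/
theorem rowPair_nonneg_of_not_split [LinearOrder R] [IsStrictOrderedRing R] {c g g' : R}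
    (hg : 0 ≤ g) (hgc : g ≤ c) (hg' : 0 ≤ g') (hgc' : g' ≤ c)
    (z io ib z' io' ib' : R) (hz : z = 0 ∨ z = 1) (hio : io = 0 ∨ io = 1) (hib : ib = 0 ∨ ib = 1)
    (hz' : z' = 0 ∨ z' = 1) (hio' : io' = 0 ∨ io' = 1) (hib' : ib' = 0 ∨ ib' = 1)
    (hns : ¬ ((io = 1 ∧ ib = 0 ∧ io' = 0 ∧ ib' = 1) ∨ (io = 0 ∧ ib = 1 ∧ io' = 1 ∧ ib' = 0))) :
    0 ≤ rowPair c z (z * io) (z * ib) (z * io * g) (z * ib * g) (z * io * ib * g)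
      z' (z' * io') (z' * ib') (z' * io' * g') (z' * ib' * g') (z' * io' * ib' * g') := by
  unfold rowPair
  rcases hz with rfl | rfl <;> rcases hz' with rfl | rfl <;>
    rcases hio with rfl | rfl <;> rcases hib with rfl | rfl <;>
    rcases hio' with rfl | rfl <;> rcases hib' with rfl | rfl <;>
    norm_num at hns <;> (try norm_num) <;> nlinarith [hg, hgc, hg', hgc']

/-- **The sign table, split pairs**: `o ∈ K ∌ b`, `b ∈ K′ ∌ o` (both on `Q`) give
`Φ_c = c − γ − γ′`. -/
theorem rowPair_split (c g g' : R) :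
    rowPair c 1 1 0 g 0 0 1 0 1 0 g' 0 = c - g - g' := by
  unfold rowPair
  ring

end Kernel

section DoubleSum

variable {V : Type*} {E : Type*} [Fintype E] [DecidableEq E] [Fintype V] [DecidableEq V]
  {R : Type*} [Field R]
variable {ends : E → Sym2 V}

/-- A product of two expectations is a double sum. -/
lemma expect_mul_expect (p : E → R) (f g : Config E → R) :
    expect p f * expect p g = ∑ ω, ∑ ω', weight p ω * weight p ω' * (f ω * g ω') := by
  unfold expect
  rw [Finset.sum_mul_sum]
  refine Finset.sum_congr rfl fun ω _ => Finset.sum_congr rfl fun ω' _ => ?_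
  ring

/-- **`2·crossC` is the double sum of the row-pair kernel** over ordered pairs of configurations:
`2·crossC(p; c) = Σ_{ω, ω'} w(ω) w(ω') Φ_c(row(ω), row(ω'))`. -/
theorem two_mul_crossC_eq_rowPair_sum (p : E → R) (c : R) (o a₁ a₂ v b : V) :
    2 * crossC p c ends o a₁ a₂ v b =
      ∑ ω, ∑ ω', weight p ω * weight p ω' *
        rowPair c (rowZ ends a₁ a₂ ω) (rowX ends o a₁ a₂ ω) (rowX ends b a₁ a₂ ω)
          (rowXV p ends o a₁ a₂ v ω) (rowXV p ends b a₁ a₂ v ω) (rowDV p ends o a₁ a₂ v b ω)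
          (rowZ ends a₁ a₂ ω') (rowX ends o a₁ a₂ ω') (rowX ends b a₁ a₂ ω')
          (rowXV p ends o a₁ a₂ v ω') (rowXV p ends b a₁ a₂ v ω') (rowDV p ends o a₁ a₂ v b ω') := by
  -- the masses as expectations of the row values
  have hZ := expect_rowZ_eq (R := R) p (ends := ends) a₁ a₂
  have hX := expect_rowX_eq (R := R) p (ends := ends) o a₁ a₂
  have hY := expect_rowX_eq (R := R) p (ends := ends) b a₁ a₂
  have hXV := expect_rowXV_eq p (ends := ends) o a₁ a₂ v
  have hYV := expect_rowXV_eq p (ends := ends) b a₁ a₂ v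
  have hDV := expect_rowDV_eq p (ends := ends) o a₁ a₂ v b
  -- expand the double sum of the kernel into products of expectations
  have key : ∑ ω, ∑ ω', weight p ω * weight p ω' *
      rowPair c (rowZ ends a₁ a₂ ω) (rowX ends o a₁ a₂ ω) (rowX ends b a₁ a₂ ω)
        (rowXV p ends o a₁ a₂ v ω) (rowXV p ends b a₁ a₂ v ω) (rowDV p ends o a₁ a₂ v b ω)
        (rowZ ends a₁ a₂ ω') (rowX ends o a₁ a₂ ω') (rowX ends b a₁ a₂ ω')
        (rowXV p ends o a₁ a₂ v ω') (rowXV p ends b a₁ a₂ v ω') (rowDV p ends o a₁ a₂ v b ω') =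
      2 * (expect p (rowZ ends a₁ a₂) * expect p (rowDV p ends o a₁ a₂ v b) +
          expect p (rowDV p ends o a₁ a₂ v b) * expect p (rowZ ends a₁ a₂)) -
        (expect p (rowX ends b a₁ a₂) * expect p (rowXV p ends o a₁ a₂ v) +
          expect p (rowXV p ends o a₁ a₂ v) * expect p (rowX ends b a₁ a₂)) -
        (expect p (rowX ends o a₁ a₂) * expect p (rowXV p ends b a₁ a₂ v) +
          expect p (rowXV p ends b a₁ a₂ v) * expect p (rowX ends o a₁ a₂)) +
        c * (expect p (rowX ends o a₁ a₂) * expect p (rowX ends b a₁ a₂) +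
          expect p (rowX ends b a₁ a₂) * expect p (rowX ends o a₁ a₂)) := by
    simp only [expect_mul_expect]
    simp only [Finset.mul_sum, ← Finset.sum_add_distrib, ← Finset.sum_sub_distrib]
    refine Finset.sum_congr rfl fun ω _ => Finset.sum_congr rfl fun ω' _ => ?_
    unfold rowPair
    ring
  rw [key, hZ, hX, hY, hXV, hYV, hDV]
  unfold crossC
  ring

end DoubleSum

end CrossAPrimeRowPairs

end Summit.Ventures.PercRepro2
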